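/-
Copyright (c) 2026. Released under Apache 2.0 license.
-/
import Literature.NumberTheory.Automorphic.UnboundedDenominatorsInvariantHom
import Mathlib.GroupTheory.QuotientGroup.Basic
import HarnessLib

/-!
# Invariant homomorphisms on `Γ(N)` as central extensions of `SL₂(ℤ/N)`: the transfer/Sylow reduction

For an `SL₂(ℤ)`-conjugation-invariant homomorphism `θ : Γ(N) → Q` (`Q` commutative) the subgroup
`K_θ = {x ∈ Γ(N) | θ x = 1}`, realised in `SL₂(ℤ)` as `θ.ker.map Γ(N).subtype`, is NORMAL in `SL₂(ℤ)`, and in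
`G = SL₂(ℤ)/K_θ` the image `Z` of `Γ(N)` is CENTRAL (`G/Z = SL₂(ℤ/N)`): the invariant form of
[CalegariDimitrovTang2025, Cor. 4.5.3] is a statement about finite central extensions of `SL₂(ℤ/N)` realised as
quotients of `SL₂(ℤ)`.  This file sets up that dictionary and the two reductions every proof of a case of the
invariant form goes through:

* `map_eq_one_of_mem_Gamma_mul_of_commutator` — **criterion**: if `θ` kills every `x ∈ Γ(N)` whose image lies in
  `[G, G]` (i.e. `Z ∩ [G,G] = 1`), then `θ` kills `Γ(12N)` (because `Γ(12N) ≤ Γ(N) ∩ [SL₂(ℤ), SL₂(ℤ)]`,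
  `ModularGroupCommutatorCongruence`).  This is the non-exceptional mechanism (it cannot apply when `4 ∣ N` and
  `θ` is the invariant character at `2` of `UnboundedDenominatorsCommutatorLevelBound`).
* `map_eq_one_of_mem_Gamma_mul_of_local` — **transfer reduction** (Schur/Sylow): if `Q` is finite of order
  prime to `[SL₂(ℤ) : H]` for a subgroup `Γ(N) ≤ H ≤ SL₂(ℤ)`, it suffices that `θ` kills every
  `y ∈ Γ(N) ∩ ([H, H]·K_θ)` — a LOCAL statement about the single subgroup `H` (the preimage of a subgroup of
  `SL₂(ℤ/N)` of index prime to `|Q|`, e.g. of a Sylow subgroup, a Borel subgroup or a Cartan normaliser).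

Not here: the local statements themselves (see the crux memo `Lines/cdt_thm1-hcor-structure-g40.md`).
-/

open scoped MatrixGroups

namespace Literature.NumberTheory.Automorphic

namespace UnboundedDenominators

open CongruenceSubgroup Matrix.SpecialLinearGroup ModularGroup

variable {N : ℕ} {Q : Type*} [CommGroup Q]

/-! ### The kernel `K_θ ≤ SL₂(ℤ)` and the central extension `SL₂(ℤ)/K_θ → SL₂(ℤ/N)` -/

/-- Membership in `K_θ = θ.ker.map Γ(N).subtype`: `x ∈ K_θ ↔ x ∈ Γ(N) ∧ θ x = 1`.
[cite: CalegariDimitrovTang2025, Corollary 4.5.3] -/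
theorem mem_ker_map_subtype_iff (θ : Gamma N →* Q) {x : SL(2, ℤ)} :
    x ∈ θ.ker.map (Gamma N).subtype ↔ ∃ hx : x ∈ Gamma N, θ ⟨x, hx⟩ = 1 := by
  constructor
  · rintro ⟨y, hy, rfl⟩
    exact ⟨y.2, hy⟩
  · rintro ⟨hx, h⟩
    exact ⟨⟨x, hx⟩, h, rfl⟩

/-- `K_θ ≤ Γ(N)`. [cite: CalegariDimitrovTang2025, Corollary 4.5.3] -/
theorem ker_map_subtype_le (θ : Gamma N →* Q) : θ.ker.map (Gamma N).subtype ≤ Gamma N := by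
  rintro _ ⟨y, -, rfl⟩
  exact y.2

/-- For an `SL₂(ℤ)`-invariant `θ`, `K_θ` is normal in `SL₂(ℤ)`. [cite: CalegariDimitrovTang2025, Corollary 4.5.3] -/
theorem ker_map_subtype_normal (θ : Gamma N →* Q)
    (hθ : ∀ (g x : SL(2, ℤ)) (hx : x ∈ Gamma N) (hgx : g * x * g⁻¹ ∈ Gamma N),
      θ ⟨g * x * g⁻¹, hgx⟩ = θ ⟨x, hx⟩) :
    (θ.ker.map (Gamma N).subtype).Normal := by
  refine ⟨fun x hx g ↦ ?_⟩
  obtain ⟨hxN, h1⟩ := (mem_ker_map_subtype_iff θ).mp hx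
  have hgx : g * x * g⁻¹ ∈ Gamma N := (Gamma_normal N).conj_mem x hxN g
  exact (mem_ker_map_subtype_iff θ).mpr ⟨hgx, by rw [hθ g x hxN hgx, h1]⟩

/-- For an `SL₂(ℤ)`-invariant `θ`, the image of `Γ(N)` in `SL₂(ℤ)/K_θ` is central (`θ(gxg⁻¹x⁻¹) = 1`).
[cite: CalegariDimitrovTang2025, Corollary 4.5.3] -/
theorem mk_mem_center_of_mem_Gamma (θ : Gamma N →* Q)
    (hθ : ∀ (g x : SL(2, ℤ)) (hx : x ∈ Gamma N) (hgx : g * x * g⁻¹ ∈ Gamma N),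
      θ ⟨g * x * g⁻¹, hgx⟩ = θ ⟨x, hx⟩)
    [hK : (θ.ker.map (Gamma N).subtype).Normal] {x : SL(2, ℤ)} (hx : x ∈ Gamma N) :
    QuotientGroup.mk' (θ.ker.map (Gamma N).subtype) x ∈
      Subgroup.center (SL(2, ℤ) ⧸ θ.ker.map (Gamma N).subtype) := by
  rw [Subgroup.mem_center_iff]
  intro g
  obtain ⟨g, rfl⟩ := QuotientGroup.mk'_surjective _ g
  rw [← map_mul, ← map_mul, QuotientGroup.mk'_eq_mk']
  have h1 : g⁻¹ * x * g⁻¹⁻¹ ∈ Gamma N := (Gamma_normal N).conj_mem x hx g⁻¹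
  have h2 : g⁻¹ * x * g ∈ Gamma N := by simpa only [inv_inv] using h1
  have h12 : (⟨g⁻¹ * x * g⁻¹⁻¹, h1⟩ : Gamma N) = ⟨g⁻¹ * x * g, h2⟩ :=
    Subtype.ext (show g⁻¹ * x * g⁻¹⁻¹ = g⁻¹ * x * g by rw [inv_inv])
  have hmem : x⁻¹ * (g⁻¹ * x * g) ∈ Gamma N := mul_mem (inv_mem hx) h2
  refine ⟨x⁻¹ * (g⁻¹ * x * g), (mem_ker_map_subtype_iff θ).mpr ⟨hmem, ?_⟩, by group⟩
  have heq : (⟨x⁻¹ * (g⁻¹ * x * g), hmem⟩ : Gamma N) = ⟨x, hx⟩⁻¹ * ⟨g⁻¹ * x * g, h2⟩ := rfl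
  have h3 := hθ g⁻¹ x hx h1
  rw [h12] at h3
  rw [heq, map_mul, map_inv, h3, inv_mul_cancel]

/-- The quotient `(SL₂(ℤ)/K_θ)/Z ≅ SL₂(ℤ)/Γ(N)`: the image of `Γ(N)` in `SL₂(ℤ)/K_θ` has index `[SL₂(ℤ) : Γ(N)]`.
[cite: CalegariDimitrovTang2025, Corollary 4.5.3] -/
theorem index_map_mk'_eq (θ : Gamma N →* Q) [hK : (θ.ker.map (Gamma N).subtype).Normal]
    (H : Subgroup SL(2, ℤ)) (hH : Gamma N ≤ H) :
    (H.map (QuotientGroup.mk' (θ.ker.map (Gamma N).subtype))).index = H.index := by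
  rw [Subgroup.index_map, QuotientGroup.ker_mk', sup_eq_left.mpr ((ker_map_subtype_le θ).trans hH),
    MonoidHom.range_eq_top.mpr (QuotientGroup.mk'_surjective _), Subgroup.index_top, mul_one]

/-! ### The criterion and the transfer reduction -/

/-- **Criterion.** If an `SL₂(ℤ)`-invariant `θ : Γ(N) → Q` kills every `x ∈ Γ(N)` whose image in `G = SL₂(ℤ)/K_θ`
lies in `[G, G]` — i.e. `Z ∩ [G, G] = 1` for the central extension `Z → G → SL₂(ℤ/N)` — then `θ` kills `Γ(12N)`
(since `Γ(12N) ≤ Γ(N) ∩ [SL₂(ℤ), SL₂(ℤ)]`). [cite: CalegariDimitrovTang2025, Corollary 4.5.3] -/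
theorem map_eq_one_of_mem_Gamma_mul_of_commutator (θ : Gamma N →* Q)
    [hK : (θ.ker.map (Gamma N).subtype).Normal]
    (h : ∀ (x : SL(2, ℤ)) (hx : x ∈ Gamma N),
      QuotientGroup.mk' (θ.ker.map (Gamma N).subtype) x ∈
        commutator (SL(2, ℤ) ⧸ θ.ker.map (Gamma N).subtype) → θ ⟨x, hx⟩ = 1)
    (x : SL(2, ℤ)) (hx : x ∈ Gamma N) (hx12 : x ∈ Gamma (12 * N)) : θ ⟨x, hx⟩ = 1 := by
  apply h x hx
  have hc : x ∈ commutator SL(2, ℤ) :=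
    (Subgroup.mem_inf.mp (Literature.NumberTheory.ModularForms.SL2Z.Gamma_mul_le_inf_commutator N hx12)).2
  have h1 := Subgroup.mem_map_of_mem (QuotientGroup.mk' (θ.ker.map (Gamma N).subtype)) hc
  rw [commutator_def, Subgroup.map_commutator] at h1
  rw [commutator_def]
  exact Subgroup.commutator_mono le_top le_top h1

/-- **Transfer (Schur/Sylow) reduction.** Let `θ : Γ(N) → Q` be `SL₂(ℤ)`-invariant with `Q` finite commutative, and
let `Γ(N) ≤ H ≤ SL₂(ℤ)` have index prime to `|Q|`.  If `θ` kills every `y ∈ Γ(N)` lying in `[H, H]·K_θ` (the LOCAL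
condition: in `G = SL₂(ℤ)/K_θ`, `Z ∩ [H̄, H̄] = 1` for the image `H̄` of `H`), then `θ` kills `Γ(12N)`.  Proof: for
`x ∈ Γ(N)` with central image `z ∈ [G, G]`, the transfer `G → H̄ᵃᵇ` gives `z^{[G:H̄]} ∈ [H̄, H̄]`
(`pow_index_mem_commutator_of_mem_center`), so `θ(x)^{[SL₂(ℤ):H]} = 1`, and `θ(x)^{|Q|} = 1`.
[cite: CalegariDimitrovTang2025, Corollary 4.5.3] -/
theorem map_eq_one_of_mem_Gamma_mul_of_local [Finite Q] (θ : Gamma N →* Q)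
    (hθ : ∀ (g x : SL(2, ℤ)) (hx : x ∈ Gamma N) (hgx : g * x * g⁻¹ ∈ Gamma N),
      θ ⟨g * x * g⁻¹, hgx⟩ = θ ⟨x, hx⟩)
    [hK : (θ.ker.map (Gamma N).subtype).Normal]
    (H : Subgroup SL(2, ℤ)) [H.FiniteIndex] (hH : Gamma N ≤ H) (hcop : (Nat.card Q).Coprime H.index)
    (loc : ∀ (y : SL(2, ℤ)) (hy : y ∈ Gamma N), y ∈ ⁅H, H⁆ ⊔ θ.ker.map (Gamma N).subtype → θ ⟨y, hy⟩ = 1)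
    (x : SL(2, ℤ)) (hx : x ∈ Gamma N) (hx12 : x ∈ Gamma (12 * N)) : θ ⟨x, hx⟩ = 1 := by
  refine map_eq_one_of_mem_Gamma_mul_of_commutator θ (fun y hy hyc ↦ ?_) x hx hx12
  set K : Subgroup SL(2, ℤ) := θ.ker.map (Gamma N).subtype with hKdef
  set π : SL(2, ℤ) →* SL(2, ℤ) ⧸ K := QuotientGroup.mk' K with hπ
  set H' : Subgroup (SL(2, ℤ) ⧸ K) := H.map π with hH'
  have hidx : H'.index = H.index := index_map_mk'_eq θ H hH
  haveI : H'.FiniteIndex := ⟨by rw [hidx]; exact Subgroup.FiniteIndex.index_ne_zero⟩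
  have hyH' : π y ∈ H' := Subgroup.mem_map_of_mem π (hH hy)
  have hcen : π y ∈ Subgroup.center (SL(2, ℤ) ⧸ K) := mk_mem_center_of_mem_Gamma θ hθ hy
  have ht := pow_index_mem_commutator_of_mem_center H' hyH' hcen hyc
  -- push the conclusion of the transfer lemma back to `SL₂(ℤ)`
  have hmapcomm : (commutator H').map H'.subtype = ⁅H', H'⁆ := by
    rw [commutator_def, Subgroup.map_commutator, ← MonoidHom.range_eq_map, Subgroup.range_subtype]
  have h2 : (π y) ^ H'.index ∈ ⁅H', H'⁆ := by
    rw [← hmapcomm]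
    exact ⟨_, ht, by simp⟩
  have h1 : π (y ^ H.index) ∈ (⁅H, H⁆).map π := by
    rw [map_pow, ← hidx, Subgroup.map_commutator]
    exact h2
  obtain ⟨c, hc, hcy⟩ := h1
  have hyn : y ^ H.index ∈ ⁅H, H⁆ ⊔ K := by
    rw [Subgroup.mem_sup_of_normal_right]
    refine ⟨c, hc, c⁻¹ * y ^ H.index, ?_, by group⟩
    rw [← QuotientGroup.eq, ← QuotientGroup.mk'_apply, ← QuotientGroup.mk'_apply, ← hπ, hcy]
  have hθn : θ ⟨y, hy⟩ ^ H.index = 1 := by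
    have := loc (y ^ H.index) (Subgroup.pow_mem _ hy _) hyn
    rwa [← map_pow]
  have h2 : θ ⟨y, hy⟩ ^ Nat.card Q = 1 := pow_card_eq_one'
  have h3 : orderOf (θ ⟨y, hy⟩) ∣ Nat.gcd (Nat.card Q) H.index :=
    Nat.dvd_gcd (orderOf_dvd_of_pow_eq_one h2) (orderOf_dvd_of_pow_eq_one hθn)
  rw [Nat.Coprime.gcd_eq_one hcop, Nat.dvd_one] at h3
  exact orderOf_eq_one_iff.mp h3

/-- The transfer reduction in the exact shape of the invariant form of CDT Cor. 4.5.3: under the local condition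
for a subgroup `H ⊇ Γ(N)` of index prime to `|Q|`, the conclusion holds with `M = 12N`.
[cite: CalegariDimitrovTang2025, Corollary 4.5.3] -/
theorem cor453_invariant_form_of_local (N : ℕ) (hN : N ≠ 0) (Q : Type*) [CommGroup Q] [Finite Q]
    (θ : Gamma N →* Q)
    (hθ : ∀ (g x : SL(2, ℤ)) (hx : x ∈ Gamma N) (hgx : g * x * g⁻¹ ∈ Gamma N),
      θ ⟨g * x * g⁻¹, hgx⟩ = θ ⟨x, hx⟩)
    (H : Subgroup SL(2, ℤ)) [H.FiniteIndex] (hH : Gamma N ≤ H) (hcop : (Nat.card Q).Coprime H.index)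
    (loc : ∀ (y : SL(2, ℤ)) (hy : y ∈ Gamma N), y ∈ ⁅H, H⁆ ⊔ θ.ker.map (Gamma N).subtype → θ ⟨y, hy⟩ = 1) :
    ∃ M : ℕ, M ≠ 0 ∧ ∀ (x : SL(2, ℤ)) (hx : x ∈ Gamma N), x ∈ Gamma M → θ ⟨x, hx⟩ = 1 := by
  haveI := ker_map_subtype_normal θ hθ
  exact ⟨12 * N, Nat.mul_ne_zero (by norm_num) hN,
    fun x hx hx12 ↦ map_eq_one_of_mem_Gamma_mul_of_local θ hθ H hH hcop loc x hx hx12⟩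

end UnboundedDenominators

end Literature.NumberTheory.Automorphic
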